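import Summits.CriticalPhenomena.PercolationContinuityZ3.Theorems.Transplant.SkelPhiWinChainLink2
import Summits.CriticalPhenomena.PercolationContinuityZ3.Theorems.Transplant.SkelPhiConcFaceRoute
import HarnessLib

/-!
# N1 ({±1} node), (F) inner route, part R3a (hp-8 g33): **THE ROUTE DATUM FROM A PINNED SEED BY A TWO-FRAME CHAIN** — generic in the geometry.
# Setting: the face-step law `Wt`, a subbox weighting of the outer window graph `winGraph G w₀ R` on the face-step region `Rg ⊆ B_G(w₀, R)`; a kit
# centre `c` with its Step-I″ seed `S ∋ c` (internally connected from `c`); a route world `Qt` with `S ⊆ Qt ⊆ Rg`, `Qt ⊆ B_G(c, L)`; two planar windows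
# `𝒲₁, 𝒲₂` of the INNER window graph `winGraph G c L` (the bridge frame and the band frame) with schedule frames `S₁, S₂` and chain data `P₁, P₂`
# (source `c`, support `Qt`), whose region windows lie in `Qt` OFF the seed; the hop = a `P_q`-certified link from a sub-seed into the first core
# window; the KNLevels chain property at `(δ ↦ ε)`; per-step kits / counts / rim excess under the route law `Skel.routeW G Wt Qt S`.
# Conclusion: `1 − ε < P_{Wt}(linkIn Qt S Ft)` for every `Ft ⊇` the last true target with `S ∩ Ft = ∅` — the (h3) input of p1-g11's `kitClauseA'`
# for a face-step kit (lane 2026-08-21 16:5xZ: hop + bridge + band per near contact; p3-g9's (R) chain is the same structure under `W0pin`).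

builds on p205010 (kernel theorem, internal audit signed; external expert review pending) — nothing in this file uses p205010; nothing here is a
claim about the open node `SamePDropOfSkeletonNeg`.
Lane `prim-bschramm`, seat `prim-hp-8` (gen 33); helper file (`--supports stmt-CriticalPhenomena-4575 --as helper`).  INPUTS: my
`WinChainData.lt_real_linkIn_of_chainF₂` (p289460), hp-8 g24's `Skel.routeW / isSubbox_routeW / finSupp_routeW` (SkelRouteLaw) and
`Skel.hsrc_routeW_of_linkIn` (SkelPhiConcFaceRoute §4).
* **`Skelφ.linkIn_of_chain₂`**.
[cite: KozmaNitzan2024, §4 Lemma 10 Step IV (p. 20), Lemma 11 (pp. 22–23: the wired cube, Ω), Lemma 12 (pp. 23–25), p. 24 (P(o ↔^A ·))]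
-/

noncomputable section

open MeasureTheory
open scoped Classical

namespace Summit.CriticalPhenomena.PercolationContinuityZ3.Theorems.Transplant

namespace Skelφ

open Literature.Probability.Percolation Literature.Probability.LatticeModels SimpleGraph KNLevels ChainPlanar
open Literature.Barriers.CriticalPhenomena (graphBall graphBall_mono)
open Skel (winGraph routeW)

variable {V : Type} [DecidableEq V] [Countable V] {G : SimpleGraph V} [G.LocallyFinite]

/-- **THE ROUTE DATUM FROM A PINNED SEED BY A TWO-FRAME CHAIN** (see the module docstring).
[cite: KozmaNitzan2024, §4 Lemma 10 Step IV (p. 20), Lemma 11 (pp. 22–23), Lemma 12 (pp. 23–25)] -/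
theorem linkIn_of_chain₂ {w₀ c : V} {R L : ℕ} {Wt : Sym2 V → unitInterval} {q : unitInterval} {Rg Qt S : Finset V}
    (hWG : ∀ e, e ∉ G.edgeSet → Wt e = 0) (hWD : IsSubbox (winGraph G w₀ R) Wt q Rg) (hRg : ∀ u ∈ Rg, u ∈ graphBall G w₀ R)
    (hQ : Qt ⊆ Rg) (hQL : ∀ u ∈ Qt, u ∈ graphBall G c L)
    -- the seed
    (hSQ : S ⊆ Qt) (hcS : c ∈ S) (hconn : ∀ s ∈ S, PathIn G (↑S : Set V) c s)
    -- the two frames and the chain data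
    (𝒲₁ 𝒲₂ : PlanarWindow (winGraph G c L)) (S₁ S₂ : SchedFrame) (P₁ P₂ : WinChainData V)
    (hPo₁ : P₁.o = c) (hPo₂ : P₂.o = c) (hPS₁ : P₁.Sfin = Qt) (hPS₂ : P₂.Sfin = Qt)
    (hRl₁ : P₁.Rlev + 1 ≤ S₁.R') (hRim₁ : ∀ k, P₁.Rim k ⊆ 𝒲₁.stepDF S₁ k) (hTne₁ : ∀ k ≤ S₁.N, (𝒲₁.coreTF S₁ k).Nonempty)
    (hRl₂ : P₂.Rlev + 1 ≤ S₂.R') (hRim₂ : ∀ k, P₂.Rim k ⊆ 𝒲₂.stepDF S₂ k) (hTne₂ : ∀ k ≤ S₂.N, (𝒲₂.coreTF S₂ k).Nonempty)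
    (hj₁ : P₁.j₁ ≤ P₁.Rlev) (hj₂ : P₂.j₁ ≤ P₂.Rlev)
    -- rooms: regions inside the route world and off the seed; the cross link; the last true target
    (hDQ₁ : ∀ k ≤ S₁.N, 𝒲₁.stepDF S₁ k ⊆ Qt) (hDQ₂ : ∀ k ≤ S₂.N, 𝒲₂.stepDF S₂ k ⊆ Qt)
    (hDS₁ : ∀ k ≤ S₁.N, Disjoint S (𝒲₁.stepDF S₁ k)) (hDS₂ : ∀ k ≤ S₂.N, Disjoint S (𝒲₂.stepDF S₂ k))
    (hx : 𝒲₁.coreTF S₁ S₁.N ⊆ 𝒲₂.W (S₂.core 0)) {Ft : Finset V} (hTn : 𝒲₂.coreTF S₂ S₂.N ⊆ Ft) (hSF : Disjoint S Ft)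
    -- the hop: a `P_q`-link inside `U ⊆ Qt` from a sub-seed `S₀ ⊆ S ⊆ U` into the first core window
    {U S₀ T₀ : Finset V} (hUQ : U ⊆ Qt) (hS₀ : S₀ ⊆ S) (hSU : S ⊆ U) (hT₀ : T₀ ⊆ 𝒲₁.W (S₁.core 0)) {Δ' : ℕ} {δ ε η : ℝ}
    (hlink : 1 - δ < (bondPercolation G q).real (linkIn (↑U : Set V) S₀ T₀))
    -- the chain property of the inner window graph at `(δ ↦ ε)`
    (hchain : ∀ (W : Sym2 V → unitInterval) (s : Fin (S₁.N + 1 + S₂.N + 1) → TStep (winGraph G c L))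
      (T' : Fin (S₁.N + 1 + S₂.N + 1) → Finset V) (η : ℝ),
      (∀ i, (s i).L.o = (s 0).L.o) →
      (∀ i : Fin (S₁.N + 1 + S₂.N), T' (Fin.castSucc i) ⊆ (s i.succ).L.X 0) →
      (∀ i, T' i ⊆ (s i).T) →
      (∀ i, (s i).KitsAt W q Δ' δ) →
      η ≤ δ / 2 →
      (∀ i, (prodBernoulli W).real (⋃ t ∈ (s i).T \ T' i, openConn (s 0).L.o t) ≤ η) →
      1 - δ < (prodBernoulli W).real (s 0).L.reachB →
        1 - ε < (prodBernoulli W).real (⋃ t ∈ T' (Fin.last (S₁.N + 1 + S₂.N)), openConn (s 0).L.o t))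
    -- analytic inputs under the route law: counts, kits, rim excess
    (hcount₁ : 1 / (1 - (q : ℝ)) ^ (Δ' * P₁.N) ≤ δ * ((Finset.Icc P₁.j₀ P₁.j₁).card : ℝ))
    (hcount₂ : 1 / (1 - (q : ℝ)) ^ (Δ' * P₂.N) ≤ δ * ((Finset.Icc P₂.j₀ P₂.j₁).card : ℝ))
    (hkits₁ : ∀ k ≤ S₁.N, ∀ j ∈ Finset.Icc P₁.j₀ P₁.j₁, ∃ (σ : SData V) (Sz : Finset V),
      SHyp (P₁.stepLF 𝒲₁ S₁ k) j σ ∧ σ.N ≤ P₁.N ∧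
      (1 - (q : ℝ) ^ σ.sB) ^ σ.k ≤ δ ∧ Sz ⊆ (P₁.stepLF 𝒲₁ S₁ k).X j ∧ Sz ⊆ 𝒲₁.stepDF S₁ k ∧
      (∀ x ∈ σ.K, ∀ e ∈ σ.seed x, e ∉ wireSet (↑Sz : Set V)) ∧ (∀ x ∈ σ.K, σ.face x ⊆ Sz) ∧
      (∀ x ∈ σ.K, 1 - 3 * δ ≤ (prodBernoulli (routeW G Wt Qt S)).real {ω | ∃ u ∈ σ.face x,
        1 - δ < (prodBernoulli (pinW (routeW G Wt Qt S) (wireSet (↑Sz : Set V)) ω)).real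
          (⋃ t ∈ P₁.coreEF 𝒲₁ S₁ k, openConnIn (↑(𝒲₁.stepDF S₁ k) : Set V) u t)}))
    (hkits₂ : ∀ k ≤ S₂.N, ∀ j ∈ Finset.Icc P₂.j₀ P₂.j₁, ∃ (σ : SData V) (Sz : Finset V),
      SHyp (P₂.stepLF 𝒲₂ S₂ k) j σ ∧ σ.N ≤ P₂.N ∧
      (1 - (q : ℝ) ^ σ.sB) ^ σ.k ≤ δ ∧ Sz ⊆ (P₂.stepLF 𝒲₂ S₂ k).X j ∧ Sz ⊆ 𝒲₂.stepDF S₂ k ∧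
      (∀ x ∈ σ.K, ∀ e ∈ σ.seed x, e ∉ wireSet (↑Sz : Set V)) ∧ (∀ x ∈ σ.K, σ.face x ⊆ Sz) ∧
      (∀ x ∈ σ.K, 1 - 3 * δ ≤ (prodBernoulli (routeW G Wt Qt S)).real {ω | ∃ u ∈ σ.face x,
        1 - δ < (prodBernoulli (pinW (routeW G Wt Qt S) (wireSet (↑Sz : Set V)) ω)).real
          (⋃ t ∈ P₂.coreEF 𝒲₂ S₂ k, openConnIn (↑(𝒲₂.stepDF S₂ k) : Set V) u t)}))
    (hη : η ≤ δ / 2)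
    (hexc₁ : ∀ k ≤ S₁.N, (prodBernoulli (routeW G Wt Qt S)).real (⋃ t ∈ P₁.Rim k, openConn c t) ≤ η)
    (hexc₂ : ∀ k ≤ S₂.N, (prodBernoulli (routeW G Wt Qt S)).real (⋃ t ∈ P₂.Rim k, openConn c t) ≤ η) :
    1 - ε < (prodBernoulli Wt).real (linkIn (↑Qt : Set V) S Ft) := by
  have hUR : U ⊆ Rg := hUQ.trans hQ
  -- the regions are subboxes of the route law in the inner window graph
  have hsub₁ : ∀ k ≤ S₁.N, IsSubbox (winGraph G c L) (routeW G Wt Qt S) q (𝒲₁.stepDF S₁ k) := fun k hk =>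
    Skel.isSubbox_routeW G hWG (hDQ₁ k hk) hQL (fun u hu => hRg u (hQ (hDQ₁ k hk hu))) (hDS₁ k hk) (hWD.anti ((hDQ₁ k hk).trans hQ))
  have hsub₂ : ∀ k ≤ S₂.N, IsSubbox (winGraph G c L) (routeW G Wt Qt S) q (𝒲₂.stepDF S₂ k) := fun k hk =>
    Skel.isSubbox_routeW G hWG (hDQ₂ k hk) hQL (fun u hu => hRg u (hQ (hDQ₂ k hk hu))) (hDS₂ k hk) (hWD.anti ((hDQ₂ k hk).trans hQ))
  have hfin₁ : FinSupp (routeW G Wt Qt S) P₁.Sfin := by rw [hPS₁]; exact Skel.finSupp_routeW G Wt Qt S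
  have hfin₂ : FinSupp (routeW G Wt Qt S) P₂.Sfin := by rw [hPS₂]; exact Skel.finSupp_routeW G Wt Qt S
  have ho₁ : ∀ k ≤ S₁.N, P₁.o ∉ 𝒲₁.stepDF S₁ k := fun k hk h => by
    rw [hPo₁] at h; exact Finset.disjoint_left.1 (hDS₁ k hk) hcS h
  have ho₂ : ∀ k ≤ S₂.N, P₂.o ∉ 𝒲₂.stepDF S₂ k := fun k hk h => by
    rw [hPo₂] at h; exact Finset.disjoint_left.1 (hDS₂ k hk) hcS h
  have hoS₁ : P₁.o ∈ P₁.Sfin := by rw [hPo₁, hPS₁]; exact hSQ hcS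
  have hoS₂ : P₂.o ∈ P₂.Sfin := by rw [hPo₂, hPS₂]; exact hSQ hcS
  -- the hop under the route law
  have hsrc : 1 - δ < (prodBernoulli (routeW G Wt Qt S)).real (⋃ t ∈ 𝒲₁.W (S₁.core 0), openConn P₁.o t) := by
    rw [hPo₁]; exact Skel.hsrc_routeW_of_linkIn hWD hRg hUQ hUR hSQ hS₀ hSU hconn hT₀ hlink
  have ho : P₂.o = P₁.o := by rw [hPo₁, hPo₂]
  have hexc₂' : ∀ k ≤ S₂.N, (prodBernoulli (routeW G Wt Qt S)).real (⋃ t ∈ P₂.Rim k, openConn P₁.o t) ≤ η := by rw [hPo₁]; exact hexc₂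
  have hexc₁' : ∀ k ≤ S₁.N, (prodBernoulli (routeW G Wt Qt S)).real (⋃ t ∈ P₁.Rim k, openConn P₁.o t) ≤ η := by rw [hPo₁]; exact hexc₁
  have key := WinChainData.lt_real_linkIn_of_chainF₂ P₁ P₂ 𝒲₁ 𝒲₂ S₁ S₂ G ho hRl₁ hRim₁ hTne₁ hRl₂ hRim₂ hTne₂ hx hchain hsub₁ hfin₁
    (fun k hk => by rw [hPS₁]; exact hDQ₁ k hk) ho₁ hoS₁ hj₁ hcount₁ hkits₁ hexc₁' hsub₂ hfin₂ (fun k hk => by rw [hPS₂]; exact hDQ₂ k hk)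
    ho₂ hoS₂ hj₂ hcount₂ hkits₂ hexc₂' hη subset_rfl hsrc hTn hSQ hSF (by rw [hPo₁]; exact hcS)
  exact key

end Skelφ

end Summit.CriticalPhenomena.PercolationContinuityZ3.Theorems.Transplant

end
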